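import Literature.Geometry.Lorentzian.KerrRedShiftEstimate
import Literature.Geometry.Lorentzian.KerrSchildLocalEnergy
import Literature.Geometry.Lorentzian.KerrSchildEnergyCurrent
import Literature.Geometry.Lorentzian.KerrSchildWaveCauchyProblem

/-!
# Route ClusterCompleteness — crux `AdiabaticMultiKerrILED`, line `Sketch`: slab Grönwall

Helper file for the crux `stmt-FinalStateConjecture-14310`
(`Summit.FinalStateConjecture.FinalStateConjecture.Theses.ClusterCompleteness.AdiabaticMultiKerrILED`),
closing the stub `stub_slabGronwall` of line `Sketch`.

This is the analytic heart of the finite-time energy estimate on the patched multi-Kerr background: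
the **weighted energy inequality of Hawking–Ellis (Lemma 4.3.1) on a slab, with Grönwall**. Let `G`
be a symmetric coefficient field on `ℝ⁴`, `W ≥ 0` a `C¹` weight supported in a closed, spatially
bounded set `K`, and `ψ` smooth with `□_G ψ = 0` at the slab points `K ∩ {0 ≤ x⁰ ≤ T}`, where `G` is
pointwise of normalised generalised Kerr–Schild form `η − φ₀ l₀ ⊗ l₀` (`0 ≤ φ₀ ≤ Φ`, `l₀` null with
`η(l₀, ∂_t) = 1`), `|∂G| ≤ D`, and the flux condition `∑_μ ∂_μW · T^{μ0}[ψ] ≤ 0` holds. Then the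
weighted energy `E_W(s) = ∫ W(s, y) T^{00}[ψ](s, y) dy` satisfies `E_W(s) ≤ E_W(0) e^{192(1+Φ)D s}` for
`0 ≤ s ≤ T`.

Proof (the pattern of `KerrSchild.Background.weightedEnergy_le`, `KerrSchildLocalEnergy.lean`, which
asks for the equation on all of `K` and a global background and so cannot be cited): the current
`J^μ = W T^{μ0}[ψ]` is `C¹` and vanishes off `K`; at slab points its divergence is
`∑_μ ∂_μW T^{μ0} + W ((□_G ψ) X + R)` (`KerrSchild.sum_fderiv_normalCurrent`), the flux term is `≤ 0`,
`□_G ψ = 0`, and `|R| ≤ 32(1+Φ)D ∑(∂ψ)² ≤ 192(1+Φ)D T^{00}` (the general-coefficient copy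
`abs_deformationTerm_le_of_pointwise` of `KerrSchild.Background.abs_deformationTerm_le`, and the
coercivity `∑(∂ψ)² ≤ 6 T^{00}` at the CONSTANT background `η − φ₀ l₀ ⊗ l₀` of the point — the current
at `x` sees only `G(x)`); the energy inequality along the flat foliation
(`E4.graphFlux_add_integral_le_of_divergence_le` with `F = 0`, `ℓ = 0`, `e = C (W T^{00})⁺`) gives
`E_W(s) ≤ E_W(0) + C ∫_0^s E_W`, and Grönwall (`norm_le_gronwallBound_of_norm_deriv_right_le` applied
to the primitive of the continuous `E_W`) concludes. Hawking–Ellis 1973, §4.3, Lemma 4.3.1;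
Dafermos–Rodnianski arXiv:0811.0354, App. D.
-/

noncomputable section

-- the doubled `FinalStateConjecture.FinalStateConjecture` path component trips dupNamespace
set_option linter.dupNamespace false

open scoped ContDiff Topology
open MeasureTheory Metric Set Literature.Geometry.Lorentzian

namespace Summit.FinalStateConjecture.FinalStateConjecture.Cruxes.AdiabaticMultiKerrILED.Sketch

/-! ### Pointwise ingredients for a general coefficient field -/

/-- The `dt`-current of a function `C²` at `x`, for coefficients `C¹` at `x`, is `C¹` at `x`
(a polynomial in `G` and `dψ`; the general-coefficient form of
`KerrSchild.Background.contDiffAt_normalCurrent`). [folklore] -/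
private theorem contDiffAt_normalCurrent_of_contDiffAt {G : E4 → Fin 4 → Fin 4 → ℝ} {w : E4 → ℝ}
    {x : E4} (hG : ∀ μ ν, ContDiffAt ℝ 1 (fun y ↦ G y μ ν) x) (hw : ContDiffAt ℝ 2 w x) (μ : Fin 4) :
    ContDiffAt ℝ 1 (fun y ↦ KerrSchild.normalCurrent G w y μ) x := by
  -- adapted from `KerrSchild.Background.contDiffAt_normalCurrent` (KerrSchildLocalEnergy.lean)
  have h2 : ContDiffAt ℝ ((1 : ℕ∞) + 1 : ℕ∞) w x := by exact_mod_cast hw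
  have hp : ∀ ν, ContDiffAt ℝ 1 (fun y ↦ fderiv ℝ w y (E4.basisVector ν)) x := fun ν ↦
    (h2.fderiv_right (m := 1) le_rfl).clm_apply contDiffAt_const
  unfold KerrSchild.normalCurrent
  exact ((ContDiffAt.sum fun ν _ ↦ (hG μ ν).mul (hp ν)).mul
    (ContDiffAt.sum fun α _ ↦ (hG 0 α).mul (hp α))).sub
    ((contDiffAt_const.mul (hG 0 μ)).mul
      (ContDiffAt.sum fun α _ ↦ ContDiffAt.sum fun β _ ↦ ((hG α β).mul (hp α)).mul (hp β)))

/-- **`|R| ≤ 32 (1 + Φ) D ∑_μ (∂_μw)²`** for a general coefficient field with `|G^{μν}(x)| ≤ 1 + Φ`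
and `|∂_μ G^{αβ}(x)| ≤ D` (the general-coefficient copy of
`KerrSchild.Background.abs_deformationTerm_le`: each piece of `KerrSchild.deformationTerm` is a
double sum `∑ a_{αβ} u_α v_β`, `Kerr.abs_sum_sum_mul_mul_le`, `(∑|p_μ|)² ≤ 4 ∑ p_μ²`). [folklore] -/
private theorem abs_deformationTerm_le_of_pointwise {G : E4 → Fin 4 → Fin 4 → ℝ} (w : E4 → ℝ)
    {x : E4} {Φ D : ℝ} (hΦ0 : 0 ≤ Φ) (hD0 : 0 ≤ D) (hA : ∀ μ ν, |G x μ ν| ≤ 1 + Φ)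
    (hD : ∀ μ α β, |fderiv ℝ (fun y ↦ G y α β) x (E4.basisVector μ)| ≤ D) :
    |KerrSchild.deformationTerm G w x| ≤
      32 * (1 + Φ) * D * ∑ μ, fderiv ℝ w x (E4.basisVector μ) ^ 2 := by
  -- adapted from `KerrSchild.Background.abs_deformationTerm_le` (KerrSchildEnergyCurrent.lean)
  set p : Fin 4 → ℝ := fun μ ↦ fderiv ℝ w x (E4.basisVector μ) with hp
  set S := ∑ μ, p μ ^ 2 with hS
  have hsum0 : 0 ≤ ∑ μ, |p μ| := Finset.sum_nonneg fun _ _ ↦ abs_nonneg _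
  have hsq : (∑ μ, |p μ|) ^ 2 ≤ 4 * S := Kerr.sq_sum_abs_le_four_mul p
  have hS0 : 0 ≤ S := Finset.sum_nonneg fun _ _ ↦ sq_nonneg _
  have hΦ1 : 0 ≤ 1 + Φ := by linarith
  -- `|∑_ν g^{μν} p_ν| ≤ (1+Φ) ∑|p|` and `|∑_β ∂_μ g^{0β} p_β| ≤ D ∑|p|`
  have hAμ : ∀ μ, |∑ ν, G x μ ν * p ν| ≤ (1 + Φ) * ∑ ν, |p ν| := by
    intro μ
    calc _ ≤ ∑ ν, |G x μ ν * p ν| := Finset.abs_sum_le_sum_abs _ _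
      _ ≤ ∑ ν, (1 + Φ) * |p ν| := Finset.sum_le_sum fun ν _ ↦ by
          rw [abs_mul]; exact mul_le_mul_of_nonneg_right (hA μ ν) (abs_nonneg _)
      _ = _ := by rw [Finset.mul_sum]
  have hBμ : ∀ μ, |∑ β, fderiv ℝ (fun y ↦ G y 0 β) x (E4.basisVector μ) * p β| ≤
      D * ∑ β, |p β| := by
    intro μ
    calc _ ≤ ∑ β, |fderiv ℝ (fun y ↦ G y 0 β) x (E4.basisVector μ) * p β| :=
          Finset.abs_sum_le_sum_abs _ _
      _ ≤ ∑ β, D * |p β| := Finset.sum_le_sum fun β _ ↦ by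
          rw [abs_mul]; exact mul_le_mul_of_nonneg_right (hD μ 0 β) (abs_nonneg _)
      _ = _ := by rw [Finset.mul_sum]
  -- term 1
  have h1 : |∑ μ, (∑ ν, G x μ ν * p ν) *
      ∑ β, fderiv ℝ (fun y ↦ G y 0 β) x (E4.basisVector μ) * p β| ≤
      16 * (1 + Φ) * D * S := by
    calc _ ≤ ∑ μ, |(∑ ν, G x μ ν * p ν) *
          ∑ β, fderiv ℝ (fun y ↦ G y 0 β) x (E4.basisVector μ) * p β| :=
          Finset.abs_sum_le_sum_abs _ _
      _ ≤ ∑ μ : Fin 4, ((1 + Φ) * ∑ ν, |p ν|) * (D * ∑ β, |p β|) :=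
          Finset.sum_le_sum fun μ _ ↦ by
            rw [abs_mul]
            exact mul_le_mul (hAμ μ) (hBμ μ) (abs_nonneg _) (by positivity)
      _ = 4 * ((1 + Φ) * D * (∑ ν, |p ν|) ^ 2) := by
          rw [Finset.sum_const, Finset.card_univ, Fintype.card_fin]; ring
      _ ≤ 4 * ((1 + Φ) * D * (4 * S)) := by gcongr
      _ = 16 * (1 + Φ) * D * S := by ring
  -- term 2
  have h2 : |2⁻¹ * (∑ μ, fderiv ℝ (fun y ↦ G y 0 μ) x (E4.basisVector μ)) *
      ∑ α, ∑ β, G x α β * p α * p β| ≤ 8 * (1 + Φ) * D * S := by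
    have hdiv : |∑ μ, fderiv ℝ (fun y ↦ G y 0 μ) x (E4.basisVector μ)| ≤ 4 * D :=
      calc _ ≤ ∑ μ, |fderiv ℝ (fun y ↦ G y 0 μ) x (E4.basisVector μ)| :=
            Finset.abs_sum_le_sum_abs _ _
        _ ≤ ∑ μ : Fin 4, D := Finset.sum_le_sum fun μ _ ↦ hD μ 0 μ
        _ = 4 * D := by rw [Finset.sum_const, Finset.card_univ, Fintype.card_fin]; ring
    have hQ := Kerr.abs_sum_sum_mul_mul_le (G x) p p hA
    rw [abs_mul, abs_mul, abs_of_pos (by norm_num : (0 : ℝ) < 2⁻¹)]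
    calc 2⁻¹ * |∑ μ, fderiv ℝ (fun y ↦ G y 0 μ) x (E4.basisVector μ)| *
          |∑ α, ∑ β, G x α β * p α * p β|
        ≤ 2⁻¹ * (4 * D) * ((1 + Φ) * (∑ μ, |p μ|) * ∑ ν, |p ν|) := by gcongr
      _ = 2 * D * (1 + Φ) * (∑ μ, |p μ|) ^ 2 := by ring
      _ ≤ 2 * D * (1 + Φ) * (4 * S) := by gcongr
      _ = 8 * (1 + Φ) * D * S := by ring
  -- term 3
  have h3 : |2⁻¹ * ∑ μ, G x 0 μ * ∑ α, ∑ β,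
      fderiv ℝ (fun y ↦ G y α β) x (E4.basisVector μ) * p α * p β| ≤
      8 * (1 + Φ) * D * S := by
    rw [abs_mul, abs_of_pos (by norm_num : (0 : ℝ) < 2⁻¹)]
    have hin : ∀ μ, |G x 0 μ * ∑ α, ∑ β,
        fderiv ℝ (fun y ↦ G y α β) x (E4.basisVector μ) * p α * p β| ≤
        (1 + Φ) * (D * (∑ α, |p α|) * ∑ β, |p β|) := by
      intro μ
      rw [abs_mul]
      exact mul_le_mul (hA 0 μ) (Kerr.abs_sum_sum_mul_mul_le _ p p (hD μ)) (abs_nonneg _) hΦ1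
    calc 2⁻¹ * |∑ μ, G x 0 μ * ∑ α, ∑ β,
          fderiv ℝ (fun y ↦ G y α β) x (E4.basisVector μ) * p α * p β|
        ≤ 2⁻¹ * ∑ μ, |G x 0 μ * ∑ α, ∑ β,
          fderiv ℝ (fun y ↦ G y α β) x (E4.basisVector μ) * p α * p β| := by
          gcongr; exact Finset.abs_sum_le_sum_abs _ _
      _ ≤ 2⁻¹ * ∑ μ : Fin 4, (1 + Φ) * (D * (∑ α, |p α|) * ∑ β, |p β|) := by
          gcongr with μ _; exact hin μ
      _ = 2 * (1 + Φ) * D * (∑ α, |p α|) ^ 2 := by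
          rw [Finset.sum_const, Finset.card_univ, Fintype.card_fin]; ring
      _ ≤ 2 * (1 + Φ) * D * (4 * S) := by gcongr
      _ = 8 * (1 + Φ) * D * S := by ring
  have hdef : KerrSchild.deformationTerm G w x =
      (∑ μ, (∑ ν, G x μ ν * p ν) *
        ∑ β, fderiv ℝ (fun y ↦ G y 0 β) x (E4.basisVector μ) * p β) -
      2⁻¹ * (∑ μ, fderiv ℝ (fun y ↦ G y 0 μ) x (E4.basisVector μ)) *
        (∑ α, ∑ β, G x α β * p α * p β) -
      2⁻¹ * ∑ μ, G x 0 μ * ∑ α, ∑ β,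
        fderiv ℝ (fun y ↦ G y α β) x (E4.basisVector μ) * p α * p β := rfl
  rw [hdef]
  calc _ ≤ |(∑ μ, (∑ ν, G x μ ν * p ν) *
        ∑ β, fderiv ℝ (fun y ↦ G y 0 β) x (E4.basisVector μ) * p β) -
      2⁻¹ * (∑ μ, fderiv ℝ (fun y ↦ G y 0 μ) x (E4.basisVector μ)) *
        (∑ α, ∑ β, G x α β * p α * p β)| +
      |2⁻¹ * ∑ μ, G x 0 μ * ∑ α, ∑ β,
        fderiv ℝ (fun y ↦ G y α β) x (E4.basisVector μ) * p α * p β| :=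
        abs_sub _ _
    _ ≤ (16 * (1 + Φ) * D * S + 8 * (1 + Φ) * D * S) + 8 * (1 + Φ) * D * S :=
        add_le_add ((abs_sub _ _).trans (add_le_add h1 h2)) h3
    _ = 32 * (1 + Φ) * D * S := by ring

/-- **Pointwise consequences of the normalised Kerr–Schild form.** If at the point `x` the
coefficients are `G(x) = η − φ₀ l₀ ⊗ l₀` with `0 ≤ φ₀ ≤ Φ`, `l₀` `η`-null and `η(l₀, ∂_t) = 1`, then
`T^{00}[w](x) ≥ 0`, `∑_μ (∂_μw)²(x) ≤ 6 T^{00}[w](x)` and `|G^{μν}(x)| ≤ 1 + Φ`: the current at `x`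
sees only `G(x)`, which is the inverse metric of the CONSTANT generalised Kerr–Schild background
`(φ₀, l₀, Φ)`, to which `KerrSchild.Background.normalCurrent_zero_nonneg`,
`…sum_sq_le_six_mul_normalCurrent_zero` and `…abs_inverseMetric_le` apply. [folklore] -/
private theorem pointwise_of_kerrSchildForm {G : E4 → Fin 4 → Fin 4 → ℝ} (w : E4 → ℝ) {x : E4}
    {Φ φ₀ : ℝ} {l₀ : E4} (hφ0 : 0 ≤ φ₀) (hφΦ : φ₀ ≤ Φ) (hnull : Minkowski.bilin l₀ l₀ = 0)
    (hnorm : Minkowski.bilin l₀ (E4.basisVector 0) = 1)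
    (hG : ∀ μ ν, G x μ ν = Kerr.etaComp μ ν - φ₀ * l₀ μ * l₀ ν) :
    0 ≤ KerrSchild.normalCurrent G w x 0 ∧
      ∑ μ, fderiv ℝ w x (E4.basisVector μ) ^ 2 ≤ 6 * KerrSchild.normalCurrent G w x 0 ∧
      ∀ μ ν, |G x μ ν| ≤ 1 + Φ := by
  let B₀ : KerrSchild.Background :=
    { φ := fun _ ↦ φ₀, l := fun _ ↦ l₀, bound := Φ, φ_nonneg := fun _ ↦ hφ0,
      φ_le := fun _ ↦ hφΦ, null := fun _ _ ↦ hnull, normalised := fun _ _ ↦ hnorm,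
      contDiff_inverseMetric := fun μ ν ↦ by
        simp only [KerrSchild.inverseMetric]
        exact contDiff_const }
  have hGx : G x = B₀.inverseMetric x := by
    funext μ ν
    rw [hG μ ν]
    rfl
  -- the current depends on the coefficients only through `G x`
  have hcur : ∀ μ, KerrSchild.normalCurrent G w x μ =
      KerrSchild.normalCurrent B₀.inverseMetric w x μ := fun μ ↦ by
    simp only [KerrSchild.normalCurrent, hGx]
  refine ⟨?_, ?_, fun μ ν ↦ ?_⟩
  · rw [hcur 0]
    exact B₀.normalCurrent_zero_nonneg w x
  · rw [hcur 0]
    exact B₀.sum_sq_le_six_mul_normalCurrent_zero w x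
  · calc |G x μ ν| = |B₀.inverseMetric x μ ν| := by rw [hGx]
      _ ≤ 1 + Φ := B₀.abs_inverseMetric_le x μ ν


/-! ### The weighted energy inequality on a slab -/

/-- **Weighted energy inequality on a slab (Hawking–Ellis, Lemma 4.3.1, slab form) with
Grönwall.** For a coefficient field `G`, a `C¹` weight `W ≥ 0` supported in a closed, spatially
bounded `K`, and a smooth `ψ` with `□_G ψ = 0` at the slab points `K ∩ {0 ≤ x⁰ ≤ T}`, where `G` is
pointwise of normalised Kerr–Schild form with profile `≤ Φ`, `|∂G| ≤ D`, and the flux condition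
`∑_μ ∂_μW · T^{μ0}[ψ] ≤ 0` holds: `E_W(s) ≤ E_W(0) e^{192(1+Φ)D s}` for `0 ≤ s ≤ T`
(`E4.graphFlux_add_integral_le_of_divergence_le` with `F = 0` for the current `W T^{μ0}[ψ]`,
`|R| ≤ 32(1+Φ)D ∑(∂ψ)² ≤ 192(1+Φ)D T^{00}` at the constant background of each point, continuity of
the weighted energy in time, Grönwall). [cite: HawkingEllis1973CUP, §4.3 Lemma 4.3.1] -/
theorem stub_slabGronwall :
    ∀ (G : E4 → Fin 4 → Fin 4 → ℝ) (W ψ : E4 → ℝ) (K : Set E4) (Φ D T ρ : ℝ),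
      0 ≤ Φ → 0 ≤ D → 0 ≤ T → IsClosed K → (∀ x ∈ K, E4.spatialNorm x ≤ ρ) →
      ContDiff ℝ 1 W → (∀ x, 0 ≤ W x) → (∀ x, W x ≠ 0 → x ∈ K) →
      (∀ x ∈ K, ∀ μ ν, ContDiffAt ℝ 2 (fun y ↦ G y μ ν) x) → (∀ x ∈ K, ∀ μ ν, G x μ ν = G x ν μ) →
      ContDiff ℝ ∞ ψ → (∀ x ∈ K, 0 ≤ x 0 → x 0 ≤ T → KerrSchild.waveOperator G ψ x = 0) →
      (∀ x ∈ K, 0 ≤ x 0 → x 0 ≤ T →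
        ∃ (φ₀ : ℝ) (l₀ : E4), 0 ≤ φ₀ ∧ φ₀ ≤ Φ ∧
          Minkowski.bilin l₀ l₀ = 0 ∧ Minkowski.bilin l₀ (E4.basisVector 0) = 1 ∧
          ∀ μ ν, G x μ ν = Kerr.etaComp μ ν - φ₀ * l₀ μ * l₀ ν) →
      (∀ x ∈ K, 0 ≤ x 0 → x 0 ≤ T →
        ∀ μ α β : Fin 4, |fderiv ℝ (fun y ↦ G y α β) x (E4.basisVector μ)| ≤ D) →
      (∀ x ∈ K, 0 ≤ x 0 → x 0 ≤ T →
        ∑ μ, fderiv ℝ W x (E4.basisVector μ) * KerrSchild.normalCurrent G ψ x μ ≤ 0) →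
      ∀ s : ℝ, 0 ≤ s → s ≤ T →
        (∫ y in Metric.closedBall (0 : E3) ρ,
            W (E4.ofTimeSpace s y) * KerrSchild.normalCurrent G ψ (E4.ofTimeSpace s y) 0) ≤
          (∫ y in Metric.closedBall (0 : E3) ρ,
            W (E4.ofTimeSpace 0 y) * KerrSchild.normalCurrent G ψ (E4.ofTimeSpace 0 y) 0) *
            Real.exp (192 * (1 + Φ) * D * s) := by
  intro G W ψ K Φ D T ρ hΦ0 hD0 _hT hK hρ hW1 hW0 hWK hG2 hGsymm hψ hsol hKS hD hflux s hs0 hsT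
  -- ### notation: the constant, the current `P = T^{μ0}[ψ]`, the weighted current `J = W P`
  set C : ℝ := 192 * (1 + Φ) * D with hC
  have hC0 : 0 ≤ C := by positivity
  set P : Fin 4 → E4 → ℝ := fun μ x ↦ KerrSchild.normalCurrent G ψ x μ with hP
  set J : Fin 4 → E4 → ℝ := fun μ x ↦ W x * P μ x with hJ
  have hψ2 : ContDiff ℝ 2 ψ := hψ.of_le (WithTop.coe_le_coe.mpr le_top)
  -- ### regularity of the current at the points of `K`, of `J` on `ℝ⁴`; vanishing off `K`
  have hP1 : ∀ μ, ∀ x ∈ K, ContDiffAt ℝ 1 (P μ) x := fun μ x hx ↦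
    contDiffAt_normalCurrent_of_contDiffAt (fun α β ↦ (hG2 x hx α β).of_le one_le_two)
      hψ2.contDiffAt μ
  have hJ1 : ∀ μ, ContDiff ℝ 1 (J μ) := fun μ ↦
    contDiff_iff_contDiffAt.mpr fun x ↦ contDiffAt_weight_mul hK subset_rfl hW1 hWK (hP1 μ) x
  have hWz : ∀ x, x ∉ K → W x = 0 := fun x hx ↦ by
    by_contra h
    exact hx (hWK x h)
  have hJK : ∀ μ x, x ∉ K → J μ x = 0 := fun μ x hx ↦ by
    simp only [hJ, hWz x hx, zero_mul]
  -- ### pointwise facts at slab points (constant background of the point)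
  have hslab : ∀ x ∈ K, 0 ≤ x 0 → x 0 ≤ T →
      0 ≤ P 0 x ∧ ∑ μ, fderiv ℝ ψ x (E4.basisVector μ) ^ 2 ≤ 6 * P 0 x ∧
        ∀ μ ν, |G x μ ν| ≤ 1 + Φ := by
    intro x hx h0 h1
    obtain ⟨φ₀, l₀, hφ0, hφΦ, hnull, hnorm, hGx⟩ := hKS x hx h0 h1
    exact pointwise_of_kerrSchildForm ψ hφ0 hφΦ hnull hnorm hGx
  have hJ0nn : ∀ x : E4, 0 ≤ x 0 → x 0 ≤ T → 0 ≤ J 0 x := by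
    intro x h0 h1
    by_cases hx : x ∈ K
    · exact mul_nonneg (hW0 x) (hslab x hx h0 h1).1
    · rw [hJK 0 x hx]
  -- ### the divergence of `J` at slab points: `∑ ∂_μ J^μ ≤ C J⁰`
  have hdivJ : ∀ x ∈ K, 0 ≤ x 0 → x 0 ≤ T →
      ∑ μ, fderiv ℝ (J μ) x (E4.basisVector μ) ≤ C * J 0 x := by
    intro x hx h0 h1
    have hPd : ∀ μ, DifferentiableAt ℝ (P μ) x := fun μ ↦
      (hP1 μ x hx).differentiableAt one_ne_zero
    have hWd : DifferentiableAt ℝ W x := (hW1.differentiable one_ne_zero) x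
    have hprod : ∀ μ κ, fderiv ℝ (J μ) x (E4.basisVector κ) =
        fderiv ℝ W x (E4.basisVector κ) * P μ x + W x * fderiv ℝ (P μ) x (E4.basisVector κ) := by
      intro μ κ
      have : J μ = fun y ↦ W y * P μ y := rfl
      rw [this, fderiv_fun_mul hWd (hPd μ)]
      simp only [add_apply, FunLike.coe_smul, Pi.smul_apply, smul_eq_mul]
      ring
    have hsum : ∑ μ, fderiv ℝ (J μ) x (E4.basisVector μ) =
        (∑ μ, fderiv ℝ W x (E4.basisVector μ) * P μ x) +
          W x * ∑ μ, fderiv ℝ (P μ) x (E4.basisVector μ) := by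
      simp only [hprod, Finset.sum_add_distrib, Finset.mul_sum]
    have hdivP := KerrSchild.sum_fderiv_normalCurrent (G := G) (w := ψ) (x := x)
      (fun μ ν ↦ (hG2 x hx μ ν).differentiableAt (by simp)) (hGsymm x hx) hψ2.contDiffAt
    have hdivP' : ∑ μ, fderiv ℝ (P μ) x (E4.basisVector μ) = KerrSchild.deformationTerm G ψ x := by
      change ∑ μ, fderiv ℝ (fun y ↦ KerrSchild.normalCurrent G ψ y μ) x (E4.basisVector μ) = _
      rw [hdivP, hsol x hx h0 h1, zero_mul, zero_add]
    obtain ⟨-, hcoer, hA⟩ := hslab x hx h0 h1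
    have hR := abs_deformationTerm_le_of_pointwise ψ hΦ0 hD0 hA (hD x hx h0 h1)
    have h3 : KerrSchild.deformationTerm G ψ x ≤ C * P 0 x := by
      have := le_abs_self (KerrSchild.deformationTerm G ψ x)
      have h4 : 32 * (1 + Φ) * D * ∑ μ, fderiv ℝ ψ x (E4.basisVector μ) ^ 2 ≤
          32 * (1 + Φ) * D * (6 * P 0 x) :=
        mul_le_mul_of_nonneg_left hcoer (by positivity)
      have h5 : 32 * (1 + Φ) * D * (6 * P 0 x) = C * P 0 x := by rw [hC]; ring
      linarith
    have h5 : W x * KerrSchild.deformationTerm G ψ x ≤ W x * (C * P 0 x) :=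
      mul_le_mul_of_nonneg_left h3 (hW0 x)
    rw [hsum, hdivP']
    calc (∑ μ, fderiv ℝ W x (E4.basisVector μ) * P μ x) + W x * KerrSchild.deformationTerm G ψ x
        ≤ 0 + W x * (C * P 0 x) := add_le_add (hflux x hx h0 h1) h5
      _ = C * J 0 x := by simp only [hJ]; ring
  -- ### the error density `e = C (J⁰)⁺`: continuous, nonnegative, `= C J⁰` on the time slab
  have hJ0c : Continuous (J 0) := (hJ1 0).continuous
  set e : E4 → ℝ := fun x ↦ C * max (J 0 x) 0 with he
  have hec : Continuous e := continuous_const.mul (hJ0c.max continuous_const)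
  have he0 : ∀ x, 0 ≤ e x := fun x ↦ mul_nonneg hC0 (le_max_right _ _)
  have heJ : ∀ x : E4, 0 ≤ x 0 → x 0 ≤ T → e x = C * J 0 x := fun x h0 h1 ↦ by
    simp only [he, max_eq_left (hJ0nn x h0 h1)]
  -- ### hypotheses of the energy inequality along the flat foliation `F = 0`
  have hρ' : ∀ x ∈ K, (0 : ℝ) ≤ x 0 → x 0 ≤ T + 0 → E4.spatialNorm x ≤ ρ :=
    fun x hx _ _ ↦ hρ x hx
  have hdiv : ∀ x ∈ K, (0 : ℝ) ≤ x 0 → x 0 ≤ T + 0 →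
      ∑ μ, fderiv ℝ (J μ) x (E4.basisVector μ) ≤ -0 + e x := by
    intro x hx h0 h1
    rw [add_zero] at h1
    rw [neg_zero, zero_add, heJ x h0 h1]
    exact hdivJ x hx h0 h1
  -- the flux density through the flat leaves is `J⁰`
  have hconormal : ∀ (t : ℝ) (y : E3),
      ∑ μ, J μ (E4.ofTimeSpace t y) * Kerr.graphConormal (fun _ : E3 ↦ (0 : ℝ)) y μ =
        J 0 (E4.ofTimeSpace t y) := by
    intro t y
    have hsucc : ∀ i : Fin 3, Kerr.graphConormal (fun _ : E3 ↦ (0 : ℝ)) y i.succ = 0 := fun i ↦ by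
      rw [Kerr.graphConormal_succ, Kerr.partialE3]
      simp
    rw [Fin.sum_univ_succ, Kerr.graphConormal_zero, mul_one]
    simp only [hsucc, mul_zero, Finset.sum_const_zero, add_zero]
  -- ### the slice function and the integral inequality `f s' ≤ f 0 + C ∫_0^s' f`
  set f : ℝ → ℝ := fun t ↦ ∫ y in closedBall (0 : E3) ρ, J 0 (E4.ofTimeSpace t y) with hf
  have hfc : Continuous f := KerrSchild.Background.continuous_ballIntegral hJ0c ρ
  have hf0 : ∀ t, 0 ≤ t → t ≤ T → 0 ≤ f t := fun t h0 h1 ↦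
    setIntegral_nonneg measurableSet_closedBall fun y _ ↦
      hJ0nn _ (by simpa using h0) (by simpa using h1)
  have hstep : ∀ s', 0 ≤ s' → s' ≤ T → f s' ≤ f 0 + C * ∫ u in Ioc 0 s', f u := by
    intro s' hs0' hsT'
    have hmain := E4.graphFlux_add_integral_le_of_divergence_le (F := fun _ ↦ (0 : ℝ))
      (ℓ := fun _ ↦ (0 : ℝ)) (e := e) (T := T) (ρ := ρ) hK hJ1 hJK contDiff_const hρ'
      continuous_const hec (fun _ _ ↦ rfl) he0 hdiv hs0' hsT'
    simp only [add_zero, hconormal, integral_zero] at hmain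
    have hinner : (∫ u in Ioc 0 s', ∫ y in closedBall (0 : E3) ρ, e (E4.ofTimeSpace u y)) =
        C * ∫ u in Ioc 0 s', f u := by
      rw [← integral_const_mul]
      refine setIntegral_congr_fun measurableSet_Ioc fun u hu ↦ ?_
      have hu0 : 0 ≤ u := hu.1.le
      have huT : u ≤ T := hu.2.trans hsT'
      simp only [hf]
      rw [← integral_const_mul]
      refine setIntegral_congr_fun measurableSet_closedBall fun y _ ↦ ?_
      exact heJ _ (by simpa using hu0) (by simpa using huT)
    have h' : f s' ≤ f 0 + ∫ u in Ioc 0 s', ∫ y in closedBall (0 : E3) ρ,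
        e (E4.ofTimeSpace u y) := hmain
    rw [hinner] at h'
    exact h'
  -- ### Grönwall, applied to the primitive `F(u) = ∫_0^u f`
  by_cases hCz : C = 0
  · -- degenerate case `C = 0`: `f s ≤ f 0`
    have h := hstep s hs0 hsT
    simp only [hCz, zero_mul, add_zero] at h
    rw [hCz, zero_mul, Real.exp_zero, mul_one]
    exact h
  have hCpos : 0 < C := lt_of_le_of_ne hC0 (Ne.symm hCz)
  set A : ℝ := f 0 with hA
  have hA0 : 0 ≤ A := hf0 0 le_rfl (hs0.trans hsT)
  have hineq' : ∀ τ', 0 ≤ τ' → τ' ≤ T → f τ' ≤ A + C * ∫ t in (0 : ℝ)..τ', f t := by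
    intro τ' h0 h1
    rw [intervalIntegral.integral_of_le h0]
    exact hstep τ' h0 h1
  set F : ℝ → ℝ := fun u ↦ ∫ t in (0 : ℝ)..u, f t with hF
  have hFderiv : ∀ u, HasDerivAt F (f u) u := fun u ↦
    intervalIntegral.integral_hasDerivAt_right (hfc.intervalIntegrable _ _)
      (hfc.stronglyMeasurableAtFilter _ _) hfc.continuousAt
  have hFcont : Continuous F := continuous_iff_continuousAt.mpr fun u ↦ (hFderiv u).continuousAt
  have hF0 : ∀ u, 0 ≤ u → u ≤ T → 0 ≤ F u := fun u hu huT ↦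
    intervalIntegral.integral_nonneg hu fun t ht ↦ hf0 t ht.1 (ht.2.trans huT)
  have hgron := norm_le_gronwallBound_of_norm_deriv_right_le (f := F) (f' := f) (δ := 0) (K := C)
    (ε := A) (a := 0) (b := T) hFcont.continuousOn (fun u _ ↦ (hFderiv u).hasDerivWithinAt)
    (by simp [hF]) (fun u hu ↦ by
      rw [Real.norm_of_nonneg (hf0 u hu.1 hu.2.le), Real.norm_of_nonneg (hF0 u hu.1 hu.2.le)]
      linarith [hineq' u hu.1 hu.2.le])
  have hFs : F s ≤ A / C * (Real.exp (C * s) - 1) := by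
    have h := hgron s ⟨hs0, hsT⟩
    rw [Real.norm_of_nonneg (hF0 s hs0 hsT), gronwallBound_of_K_ne_0 hCpos.ne', sub_zero] at h
    simpa using h
  have hfs : f s ≤ A * Real.exp (C * s) := by
    have h1 := hineq' s hs0 hsT
    have h2 : C * F s ≤ A * (Real.exp (C * s) - 1) := by
      have := mul_le_mul_of_nonneg_left hFs hCpos.le
      rwa [← mul_assoc, mul_div_cancel₀ _ hCpos.ne'] at this
    nlinarith
  exact hfs

end Summit.FinalStateConjecture.FinalStateConjecture.Cruxes.AdiabaticMultiKerrILED.Sketch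

end
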